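import Summits.PneNP.PneNP.Theorems.NegLimitedLadderOmega

/-!
# Route NegLimited — item `NeglimitedLogOverOmegaNegations` (stmt-PneNP-19555, rung R9-B) PROVED with its explicit type

The support item stmt-PneNP-19555 of route PneNP/NegLimited (cell pnp-ideate, rung F-N1/p3, line
`density-ladder`, skeleton sha 2d55ebf8 — all six registered stubs landed: `NegLimitedLadderLargeNPow`,
`…Advantage`, `…NullMass`, `…FixedK`, `…RecurringCliqueSlices`, `…Omega`): ONE explicit `NP` language
with monotone slices beats every polynomial against De Morgan circuits with `⌊log₂ n⌋ / w(n)` NOT gates,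
for EVERY unbounded budget divisor `w` (strictly between the closed rung stmt-PneNP-19657,
`w(n) = 40(⌊log₂⌊log₂ n⌋⌋ + 1)`, and the door stmt-PneNP-19860, `w` bounded).

The theorem below carries the item's signature as its explicit type (the route file
`Theses/NegLimited.lean` has not yet been re-rendered with the declaration `NeglimitedLogOverOmegaNegations`;
the proof term is the landed `NegLimitedLadder.neglimitedLogOverOmegaNegations_holds`, whose statement is the
same formula). Mechanism: Rossman's negation-limited transfer over the planted-clique monotone coupling with
a RANDOMISED background density (`rsd_at_admissible_dose` + union law, telescoping), see
`NegLimitedLadderAdvantage.lean` / `NegLimitedLadderFixedK.lean`. Honest scope: not the door (the density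
window `a = 2/(k³(k-1))` shrinks with `k`).
-/

set_option linter.dupNamespace false -- `Summit.PneNP.PneNP.…`: summit = sub-problem name (D-0017 single-conjunct layout)

namespace Summit.PneNP.PneNP.Theorems

/-- **Item stmt-PneNP-19555 (`NegLimited.NeglimitedLogOverOmegaNegations`, rung R9-B of line `density-ladder`)
PROVED, with its explicit type**: there is an `NP` language `L` such that for every `w → ∞` and every `c`,
infinitely often the slice `L_n` is monotone and needs more than `n^c` De Morgan gates when only
`⌊log₂ n⌋ / w(n)` NOT gates are allowed. -/
theorem neglimitedLogOverOmegaNegations_holds :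
    ∃ L ∈ Literature.Computability.Complexity.Nondeterministic.NP, ∀ w : ℕ → ℕ, Filter.Tendsto w Filter.atTop Filter.atTop → ∀ c : ℕ, ∃ᶠ n : ℕ in Filter.atTop, Monotone (L.sliceFn n) ∧ n ^ c < Literature.Computability.Complexity.negLimitedSizeOver Literature.Computability.Complexity.deMorganBasis (Nat.log 2 n / w n) (L.sliceFn n) :=
  NegLimitedLadder.neglimitedLogOverOmegaNegations_holds

end Summit.PneNP.PneNP.Theorems
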